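import Summits.BirchSwinnertonDyer.BirchSwinnertonDyer.Theorems.KatoDescentPotSupersingularKatoFiniteLevelCountCanonical
import Summits.BirchSwinnertonDyer.Rank1Residual.X11b.PrimaryInclusionLevels
import Literature.NumberTheory.GaloisRepresentations.ContinuousH1ResCocycle
import HarnessLib

/-!
# Kato's (14.9.3) at finite level, part 3: FROM `E[p^k]` TO `E[p^∞]` on the strict side — `ι_k : H¹(K,E[p^k]) →
# H¹(K,E[p^∞])` carries Kato's strict group `H¹_𝓢(K, E[p^k])` into `Sel_str^{ur}(K, E[p^∞])` and is INJECTIVE on it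
# as soon as `p^k` kills `E(K_{v₀})[p^∞]` for one `v₀ ∈ P`; hence `#H¹(O_K[1/p], E[p^k]) ≤ #Sel_str^{ur}(K,E[p^∞]) · ∏_{v∈P} #𝓚_v`
# (route `KatoDescentPotSupersingular` / `…Tame…`, crux M = stmt-BirchSwinnertonDyer-19196; route-free helper)

Seat `bsd-potss-rkm` g17 (prover; cell `bsd-potss`), item stmt-BirchSwinnertonDyer-19196 `ReducibleKatoMember`
(`--supports … --as helper`; closes nothing).  HONEST FRAMING: BSD is not proved by any of this; nothing is booked;
theorems only (no definition, no named fact).  Sequel of `…KatoFiniteLevelCount[Canonical]` (the finite-level count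
`#H¹_ℛ(K,E[n]) = #H¹_𝓢(K,E[n]) · ∏_{v∈P} #𝓚_v`); first kernel step of the passage to `W = E[p^∞] = lim→ E[p^k]` named
as the construction (E4) in FINDING-19196-rkm-g17 (HOME/rkm).

## What

`ι_k = H¹(primaryInclusion) : H¹(K, E[p^k]) → H¹(K, E[p^∞])` (X11b `PrimaryInclusionLevels`; kernel = the connecting
classes `δ(Q)`, `p^k·Q ∈ E(K)[p^∞]`).  For Kato's STRICT structures — `𝓢` on `E[p^k]` and `𝓢∞` on `E[p^∞]`
(`X11b.LocBridge.primaryGaloisModule W p`): zero at the finite places `v ∈ P`, UNRAMIFIED at every finite `v ∉ P`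
(bad places included), everything at the infinite places (for `𝓢∞`; `H¹(K_w, E[p^∞]) = 0` there anyway for odd `p`):

* §1 `exists_fixed_of_res_connectingClass_eq_zero` (generic, any field): if the RESTRICTION to a `K`-field `E` of a
  connecting class `δ(b)` of `0 → A —i→ B —n→ B` vanishes, then `n·b = n·b₀` for some `b₀ ∈ B` FIXED by `Γ_E`.
* §2 `map_primaryInclusion_mem_selmerGroup_strict` — **`ι_k(H¹_𝓢(K,E[p^k])) ⊆ H¹_{𝓢∞}(K,E[p^∞]) =: Sel_str^{ur}(K,E[p^∞])`**;
  `map_primaryInclusion_injOn_selmerGroup_strict` — **`ι_k` is INJECTIVE on `H¹_𝓢(K,E[p^k])` whenever `p^k` kills the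
  `Γ_{K_{v₀}}`-fixed points of `E[p^∞]` (= `E(K_{v₀})[p^∞]`) for SOME `v₀ ∈ P`**: a kernel class is `δ(Q)` with
  `b = p^k Q ∈ E(K)[p^∞]`; `loc_{v₀} δ(Q) = 0` gives `p^k Q = p^k b₀` with `b₀ ∈ E(K_{v₀})[p^∞]` (§1), so `p^k Q = 0` and
  `δ(Q) = 0`.  Hence `#H¹_𝓢(K,E[p^k]) ≤ #Sel_str^{ur}(K,E[p^∞])` (`natCard_selmerGroup_strict_le`).
* §3 **`natCard_selmerGroup_relaxed_le_of_primary`** — with part 1: **`#H¹_ℛ(K,E[p^k]) ≤ #Sel_str^{ur}(K,E[p^∞]) ·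
  ∏_{v∈P} #𝓚_v`** for every such `k` (Kato: `#H¹(O_K[1/p], E[p^k]) ≤ #Ker(H²(O_K[1/p],T) → ⊕_{v∣p}H²)^∨ · ∏_{v∣p} #E(K_v)/p^k`,
  the dual of the kernel being `Sel_str^{ur}` by (14.9.3)/(14.9.4)); canonical-family form modulo `SelmerComplement`.

The converse (surjectivity of `ι_k` onto `Sel_str^{ur}` for `k ≫ 0`, whence EQUALITY `#H¹_𝓢(K,E[p^k]) = #Sel_str^{ur}` for
`k ≫ 0`) needs the divisible-part bookkeeping at the bad places and is NOT done here (memo SPEC (E4)).  The hypothesis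
"`p^k` kills `E(K_{v₀})[p^∞]`" is THEOREM-SHAPED (local torsion is finite) and kept as a binder.

References: K. Kato, Astérisque 295 (2004) §8.2, 14.8, (14.9.3)–(14.9.4) [Kato2004Asterisque]; R. Greenberg, LNM 1716
(1999) §2 p. 63, §5 proof of Prop. 5.8 [GreenbergLNM1716]; J. H. Silverman, *AEC* VIII §2 [SilvermanAEC2009].
-/

-- the summit and its single problem are both named `BirchSwinnertonDyer` (registry layout D-0017)
set_option linter.dupNamespace false
set_option autoImplicit false

noncomputable section

open scoped Classical ContRepresentation NumberField
open Function Field NumberField IsDedekindDomain WeierstrassCurve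
open Literature.NumberTheory.EllipticCurves Literature.NumberTheory.GaloisRepresentations
  Literature.NumberTheory.GaloisRepresentations.DiscreteGaloisModule Literature.NumberTheory.GaloisCohomology
open Summit.BirchSwinnertonDyer.Rank1Residual.X11b.Levels Summit.BirchSwinnertonDyer.Rank1Residual.X11b.LocBridge
open Summit.BirchSwinnertonDyer.Rank1Residual.GaloisImage

universe u

namespace Summit.BirchSwinnertonDyer.BirchSwinnertonDyer.Theorems.KatoFiniteLevelCount

/-! ## §1 Restriction of a vanishing connecting class (generic) -/

section Generic

variable {K : Type u} [Field K] {A B : Type u} [AddCommGroup A] [TopologicalSpace A] [DiscreteTopology A]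
  [AddCommGroup B] [TopologicalSpace B] [DiscreteTopology B]
  {ρA : DiscreteGaloisModule K A} {ρB : DiscreteGaloisModule K B}
  {i : ρA.toContRepresentation →ⁱL ρB.toContRepresentation} {n : ℕ}
  {hrange : ∀ b : B, n • b = 0 → ∃ a : A, i a = b}

/-- **If the restriction to a `K`-field `E` of the connecting class `δ(b)` of `0 → A —i→ B —n→ B` vanishes, then
`n • b = n • b₀` for some `b₀ ∈ B^{Γ_E}`** (the local twin of X11b `Levels.connectingClass_eq_zero_iff`, `⟹`: on
cocycles `res δ(b) = [σ ↦ i⁻¹(σ|b − b)]` (`res_oneCocycleClass`); if it is the coboundary of `a ∈ A` then `b − i a` is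
`Γ_E`-fixed and `n • (b − i a) = n • b`). [cite: SilvermanAEC2009, VIII §2] [cite: GreenbergLNM1716, §5 proof of Prop. 5.8] -/
theorem exists_fixed_of_res_connectingClass_eq_zero (hinj : Function.Injective i) (hA : ∀ a : A, n • a = 0)
    (E : Type u) [Field E] [Algebra K E] (b : B) (hb : ∀ σ : absoluteGaloisGroup K, ρB σ (n • b) = n • b)
    (h : galoisCohomology.res ρA E 1 (connectingClass i n hrange hinj b hb) = 0) :
    ∃ b₀ : B, (∀ σ : absoluteGaloisGroup E, GaloisRep.restrictField E ρB σ b₀ = b₀) ∧ n • b₀ = n • b := by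
  rw [connectingClass, galoisCohomology.res_oneCocycleClass] at h
  obtain ⟨a, ha⟩ := (oneCocycleClass_eq_zero_iff _ _).mp h
  refine ⟨b - i a, fun σ => ?_, by rw [smul_sub, ← map_nsmul, hA, map_zero, sub_zero]⟩
  have h1 := congrArg i (ha σ)
  rw [galoisCohomology.pullback_absGaloisRestrict_apply, apply_liftCocycle,
    Rank1Residual.X11b.Levels.cobCocycle_apply, map_sub] at h1
  have h' : i ((DiscreteGaloisModule.toTopRep (ρA.restrictField E)).ρ σ a) = ρB (absGaloisRestrict K E σ) (i a) :=
    i.isIntertwining (absGaloisRestrict K E σ) a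
  rw [h'] at h1
  rw [GaloisRep.restrictField_apply, map_sub]
  calc ρB (absGaloisRestrict K E σ) b - ρB (absGaloisRestrict K E σ) (i a)
      = (ρB (absGaloisRestrict K E σ) b - b) - (ρB (absGaloisRestrict K E σ) (i a) - i a) + (b - i a) := by abel
    _ = b - i a := by rw [h1, sub_self, zero_add]

end Generic

/-! ## §2 `ι_k` maps Kato's strict group into `Sel_str^{ur}(K, E[p^∞])`, injectively once `p^k · E(K_{v₀})[p^∞] = 0` -/

section Strict

variable {K : Type u} [Field K] [NumberField K] (W : WeierstrassCurve K) (p k : ℕ)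
  (P : Finset (HeightOneSpectrum (𝓞 K)))
  (𝓢 : SelmerStructure (W.torsionGaloisModule ((p ^ k : ℕ) : ℤ)))
  (𝓢inf : SelmerStructure (primaryGaloisModule W p))

/-- **`ι_k(H¹_𝓢(K, E[p^k])) ⊆ H¹_{𝓢∞}(K, E[p^∞])`** for Kato's strict structures (`0` at `v ∈ P`, unramified at the finite
`v ∉ P`; `𝓢∞ = ⊤` at the infinite places): localisation commutes with `ι_k` (`localization_map_one'`), `ι_k 0 = 0`, and
`ι_k` preserves unramified classes (`Levels.map_mem_unramifiedSubgroup`).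
[cite: Kato2004Asterisque, §8.2 and 14.8 (pp. 181, 238)] [cite: GreenbergLNM1716, §5 proof of Prop. 5.8] -/
theorem map_primaryInclusion_mem_selmerGroup_strict
    (h𝓢P : ∀ v ∈ P, 𝓢 (Sum.inr v) = ⊥)
    (h𝓢ur : ∀ v ∉ P, 𝓢 (Sum.inr v) =
      unramifiedSubgroup (GaloisRep.toLocal v (W.torsionGaloisModule ((p ^ k : ℕ) : ℤ))) 1)
    (hIP : ∀ v ∈ P, 𝓢inf (Sum.inr v) = ⊥)
    (hIur : ∀ v ∉ P, 𝓢inf (Sum.inr v) = unramifiedSubgroup (GaloisRep.toLocal v (primaryGaloisModule W p)) 1)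
    (hIinl : ∀ w : InfinitePlace K, 𝓢inf (Sum.inl w) = ⊤)
    {c : galoisCohomology (W.torsionGaloisModule ((p ^ k : ℕ) : ℤ)) 1} (hc : c ∈ 𝓢.selmerGroup) :
    galoisCohomology.map (primaryInclusion W p k) 1 c ∈ 𝓢inf.selmerGroup := by
  rw [SelmerStructure.mem_selmerGroup_iff] at hc ⊢
  intro v
  rw [localization_map_one']
  rcases v with w | v
  · rw [hIinl w]; exact AddSubgroup.mem_top _
  · by_cases hv : v ∈ P
    · have h := hc (Sum.inr v)
      rw [h𝓢P v hv, AddSubgroup.mem_bot] at h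
      have h0 : galoisCohomology.map ((primaryInclusion W p k).restrictField (Place.Completion (Sum.inr v : Place K))) 1
          (galoisCohomology.localization (W.torsionGaloisModule ((p ^ k : ℕ) : ℤ)) (Sum.inr v) 1 c) = 0 := by
        rw [h]; exact map_zero _
      rw [h0, hIP v hv]
      exact zero_mem _
    · have h := hc (Sum.inr v)
      rw [h𝓢ur v hv] at h
      rw [hIur v hv]
      exact map_mem_unramifiedSubgroup (ρ₁ := GaloisRep.toLocal v (W.torsionGaloisModule ((p ^ k : ℕ) : ℤ)))
        (ρ₂ := GaloisRep.toLocal v (primaryGaloisModule W p))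
        ((primaryInclusion W p k).restrictField (v.adicCompletion K)) h

/-- **`ι_k` is INJECTIVE on Kato's strict group once `p^k · E(K_{v₀})[p^∞] = 0` for one `v₀ ∈ P`.**  A class `c` with
`ι_k c = 0` is a connecting class `δ(Q)`, `p^k·Q ∈ E(K)[p^∞]` (`Levels.map_primaryInclusion_eq_zero_iff`); `c ∈ H¹_𝓢`
gives `loc_{v₀} c = 0`, so `p^k·Q = p^k·b₀` with `b₀ ∈ E[p^∞]^{Γ_{K_{v₀}}}` (§1), and the hypothesis `hk` kills
`p^k·b₀`; then `δ(Q) = 0` (`Levels.connectingClass_eq_zero_iff` with `b₀ = 0`).  The hypothesis is THEOREM-SHAPED: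
`E(K_{v₀})[p^∞]` is finite, so it holds for all `k ≥ k₀(W, v₀)`. [cite: GreenbergLNM1716, §2 p. 63 and §5 proof of Prop. 5.8]
[cite: Kato2004Asterisque, (14.9.3) (p. 240)] -/
theorem map_primaryInclusion_injOn_selmerGroup_strict
    {v₀ : HeightOneSpectrum (𝓞 K)} (hv₀ : 𝓢 (Sum.inr v₀) = ⊥)
    (hk : ∀ Q : W.geomPrimaryTorsion p,
      (∀ σ : absoluteGaloisGroup (v₀.adicCompletion K),
        GaloisRep.restrictField (v₀.adicCompletion K) (primaryGaloisModule W p) σ Q = Q) → p ^ k • Q = 0)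
    {c : galoisCohomology (W.torsionGaloisModule ((p ^ k : ℕ) : ℤ)) 1} (hc : c ∈ 𝓢.selmerGroup)
    (h0 : galoisCohomology.map (primaryInclusion W p k) 1 c = 0) : c = 0 := by
  obtain ⟨Q, hQ, rfl⟩ := (map_primaryInclusion_eq_zero_iff W p k c).mp h0
  -- `loc_{v₀} δ(Q) = 0`
  have hloc : galoisCohomology.localization _ (Sum.inr v₀) 1
      (connectingClass (primaryInclusion W p k) (p ^ k) (exists_primaryInclusion_eq_of_nsmul_eq_zero W p k)
        (primaryInclusion_injective W p k) Q hQ) = 0 := by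
    have h := (SelmerStructure.mem_selmerGroup_iff _ _).mp hc (Sum.inr v₀)
    rwa [hv₀, AddSubgroup.mem_bot] at h
  obtain ⟨b₀, hb₀, hnb⟩ := exists_fixed_of_res_connectingClass_eq_zero (primaryInclusion_injective W p k)
    (pow_nsmul_geomTorsion_eq_zero W p k) (Place.Completion (Sum.inr v₀ : Place K)) Q hQ hloc
  have hzero : p ^ k • Q = 0 := by
    rw [← hnb]
    exact hk b₀ fun σ => hb₀ σ
  rw [connectingClass_eq_zero_iff (primaryInclusion_injective W p k) (pow_nsmul_geomTorsion_eq_zero W p k)]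
  exact ⟨0, fun σ => map_zero _, by rw [smul_zero, hzero]⟩

/-- **`#H¹_𝓢(K, E[p^k]) ≤ #Sel_str^{ur}(K, E[p^∞])`** for Kato's strict structures, whenever `Sel_str^{ur}(K,E[p^∞]) =
H¹_{𝓢∞}(K, E[p^∞])` is finite and `p^k` kills `E(K_{v₀})[p^∞]` for some `v₀ ∈ P` (`ι_k` restricts to an injection).
[cite: Kato2004Asterisque, (14.9.3)–(14.9.4) (p. 240)] [cite: GreenbergLNM1716, §5 proof of Prop. 5.8] -/
theorem natCard_selmerGroup_strict_le [Finite 𝓢inf.selmerGroup]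
    (h𝓢P : ∀ v ∈ P, 𝓢 (Sum.inr v) = ⊥)
    (h𝓢ur : ∀ v ∉ P, 𝓢 (Sum.inr v) =
      unramifiedSubgroup (GaloisRep.toLocal v (W.torsionGaloisModule ((p ^ k : ℕ) : ℤ))) 1)
    (hIP : ∀ v ∈ P, 𝓢inf (Sum.inr v) = ⊥)
    (hIur : ∀ v ∉ P, 𝓢inf (Sum.inr v) = unramifiedSubgroup (GaloisRep.toLocal v (primaryGaloisModule W p)) 1)
    (hIinl : ∀ w : InfinitePlace K, 𝓢inf (Sum.inl w) = ⊤)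
    {v₀ : HeightOneSpectrum (𝓞 K)} (hv₀P : v₀ ∈ P)
    (hk : ∀ Q : W.geomPrimaryTorsion p,
      (∀ σ : absoluteGaloisGroup (v₀.adicCompletion K),
        GaloisRep.restrictField (v₀.adicCompletion K) (primaryGaloisModule W p) σ Q = Q) → p ^ k • Q = 0) :
    Nat.card 𝓢.selmerGroup ≤ Nat.card 𝓢inf.selmerGroup := by
  let f : 𝓢.selmerGroup → 𝓢inf.selmerGroup := fun c =>
    ⟨galoisCohomology.map (primaryInclusion W p k) 1 c,
      map_primaryInclusion_mem_selmerGroup_strict W p k P 𝓢 𝓢inf h𝓢P h𝓢ur hIP hIur hIinl c.2⟩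
  have hf : Injective f := by
    intro x y hxy
    apply Subtype.ext
    have h : galoisCohomology.map (primaryInclusion W p k) 1 (x - y : 𝓢.selmerGroup) = 0 := by
      rw [AddSubgroupClass.coe_sub, map_sub, sub_eq_zero]
      exact congrArg Subtype.val hxy
    have := map_primaryInclusion_injOn_selmerGroup_strict W p k 𝓢 (h𝓢P v₀ hv₀P) hk (x - y).2 h
    rwa [AddSubgroupClass.coe_sub, sub_eq_zero] at this
  exact Nat.card_le_card_of_injective f hf

end Strict

/-! ## §3 With the finite-level count: `#H¹(O_K[1/p], E[p^k]) ≤ #Sel_str^{ur}(K, E[p^∞]) · ∏_{v ∈ P} #𝓚_v` -/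

section Relaxed

variable {K : Type u} [Field K] [NumberField K] (W : WeierstrassCurve K) [W.IsElliptic] (p k : ℕ) [Fact p.Prime]

/-- **`#H¹_ℛ(K, E[p^k]) ≤ #Sel_str^{ur}(K, E[p^∞]) · ∏_{v∈P} #𝓚_v`** (`p` odd, `k ≥ 1`): Kato's RELAXED group at level
`p^k` — `H¹(O_K[1/p], E[p^k])` when `P = {v ∣ p}` — is bounded by the `p^∞`-level strict group times the local Kummer
orders, for every Poitou–Tate family `inv` and every `k` with `p^k · E(K_{v₀})[p^∞] = 0` for some `v₀ ∈ P`: part 1's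
equality `#H¹_ℛ = #H¹_𝓢 · ∏ #𝓚_v` (`natCard_selmerGroup_relaxed_eq_of_weilPairing`) and §2.  Kato: `H¹(O_K[1/p],T)`,
`T = lim← E[p^k]`, against `Ker(H²(O_K[1/p],T) → ⊕_{v∣p} H²(K_v,T))^∨ = Sel_str^{ur}(K, E[p^∞])`.
[cite: Kato2004Asterisque, (14.9.3)–(14.9.4) (p. 240) and Prop. 14.16 (p. 244)] -/
theorem natCard_selmerGroup_relaxed_le_of_primary (hk1 : 1 ≤ k) (hodd : p ≠ 2)
    (inv : LocalInvariants K (p ^ k)) (hperf : inv.IsPerfect) (hsum : inv.SumLocalTermEqZero)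
    (hcompl : inv.SelmerComplement)
    (P T : Finset (HeightOneSpectrum (𝓞 K))) (hPT : P ⊆ T)
    (hP : ∀ v : HeightOneSpectrum (𝓞 K), ((p ^ k : ℕ) : 𝓞 K) ∈ v.asIdeal → v ∈ P)
    (hT : ∀ v : HeightOneSpectrum (𝓞 K), v ∉ T →
      GaloisRep.IsUnramifiedAt v (W.torsionGaloisModule ((p ^ k : ℕ) : ℤ)))
    (𝓢 ℛ : SelmerStructure (W.torsionGaloisModule ((p ^ k : ℕ) : ℤ)))
    (h𝓢P : ∀ v ∈ P, 𝓢 (Sum.inr v) = ⊥) (hℛP : ∀ v ∈ P, ℛ (Sum.inr v) = ⊤)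
    (h𝓢ur : ∀ v ∉ P, 𝓢 (Sum.inr v) =
      unramifiedSubgroup (GaloisRep.toLocal v (W.torsionGaloisModule ((p ^ k : ℕ) : ℤ))) 1)
    (hℛur : ∀ v ∉ P, ℛ (Sum.inr v) =
      unramifiedSubgroup (GaloisRep.toLocal v (W.torsionGaloisModule ((p ^ k : ℕ) : ℤ))) 1)
    (𝓢inf : SelmerStructure (primaryGaloisModule W p)) [Finite 𝓢inf.selmerGroup]
    (hIP : ∀ v ∈ P, 𝓢inf (Sum.inr v) = ⊥)
    (hIur : ∀ v ∉ P, 𝓢inf (Sum.inr v) = unramifiedSubgroup (GaloisRep.toLocal v (primaryGaloisModule W p)) 1)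
    (hIinl : ∀ w : InfinitePlace K, 𝓢inf (Sum.inl w) = ⊤)
    {v₀ : HeightOneSpectrum (𝓞 K)} (hv₀P : v₀ ∈ P)
    (hk : ∀ Q : W.geomPrimaryTorsion p,
      (∀ σ : absoluteGaloisGroup (v₀.adicCompletion K),
        GaloisRep.restrictField (v₀.adicCompletion K) (primaryGaloisModule W p) σ Q = Q) → p ^ k • Q = 0) :
    Nat.card ℛ.selmerGroup ≤
      Nat.card 𝓢inf.selmerGroup * ∏ v ∈ P, Nat.card (W.kummerSelmerStructure ((p ^ k : ℕ) : ℤ) (Sum.inr v)) := by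
  haveI : NeZero (p ^ k) := ⟨pow_ne_zero k (Fact.out : p.Prime).ne_zero⟩
  have hn : IsPrimePow (p ^ k) := (Fact.out : p.Prime).isPrimePow.pow (by omega)
  have hoddn : Odd (p ^ k) := ((Fact.out : p.Prime).odd_of_ne_two hodd).pow
  have heq := natCard_selmerGroup_relaxed_eq_of_weilPairing W (p ^ k) hn hoddn inv hperf hsum hcompl P T hPT hP hT
    𝓢 ℛ h𝓢P hℛP h𝓢ur hℛur
  rw [heq]
  exact Nat.mul_le_mul_right _
    (natCard_selmerGroup_strict_le W p k P 𝓢 𝓢inf h𝓢P h𝓢ur hIP hIur hIinl hv₀P hk)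

end Relaxed

end Summit.BirchSwinnertonDyer.BirchSwinnertonDyer.Theorems.KatoFiniteLevelCount

end
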